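import Literature.Topology.FourManifolds.LinkIsotopyWhitney
import Literature.Topology.FourManifolds.DisjointFamilyIsotopy
import Literature.Topology.FourManifolds.AttachingCircleFiveEmbedding
import Literature.Topology.FourManifolds.CircleMapsConjugateLoops
import Literature.Topology.FourManifolds.OneHandlebodyBoundaryCarrier
import HarnessLib

/-!
# Attaching circles of 5-dimensional 2-handles representing the same classes differ by a
# diffeomorphism of the 1-handlebody

Topic `Literature/Topology/FourManifolds`; assembly of bricks G2 (`OneHandlebodyBoundaryCarrier.lean`),
G4-link (`LinkIsotopyWhitney.lean`), AMB (`DisjointFamilyIsotopy.lean`), S1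
(`CircleMapsConjugateLoops.lean`) and S2 (`AttachingCircleFiveEmbedding.lean`) of the roadmap in
`PresentationHandlebodyFiveProofs.lean`:

* `Literature.Topology.FourManifolds.BoundaryData.exists_diffeomorph_apply_incl_of_homotopic_links`
  — (every dimension `n + 1 ≥ 5`) for a compact manifold with boundary `W`, a boundary datum `b`
  (`b.carrier ≅ ∂W`, a closed `n`-manifold) and two links `e₀ e₁ : Fin m → C(𝕊¹, b.carrier)`
  (smooth embeddings with pairwise disjoint images) homotopic component by component, there is a
  diffeomorphism `Φ` of `W` carrying the first link to the second, `Φ (incl (e₀ i u)) = incl (e₁ i u)`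
  (Whitney's theorem for links, `exists_smoothIsotopy_link_of_homotopic`, realised by a
  diffeomorphism of `W`, `BoundaryData.exists_diffeomorph_apply_incl_of_smoothIsotopy_family`) —
  *"in dimension 5 … attaching circles are unknotted and unlinked"* (Kirby 1989, p. 18);
* `Literature.Topology.FourManifolds.HandleAttachingMap.attachingCircle₅_homotopic_of_representsClass`
  — two attaching maps of 5-dimensional 2-handles whose attaching circles represent the same
  class `g ∈ π₁(V, v)` (`HandleAttachingMap.RepresentsClass`: the based loops
  `δ · ℓ · δ⁻¹` are both in the class `g`) have attaching circles homotopic as maps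
  `𝕊¹ → V` (`ContinuousMap.homotopic_of_conj_mk_circleLoop_eq`);
* `Literature.Topology.FourManifolds.HandleAttachingMap.boundaryCircle₅_homotopic_of_representsClass`
  — on a compact connected 5-manifold `V` with a `(1, r)` handle decomposition the lifted
  attaching circles are homotopic in the closed boundary 4-manifold `b.carrier`
  (`π₁(b.carrier) ≅ π₁(V)`, `HasHandleDecomposition.bijective_mapOfEq_inclContinuousMap`, and
  `ContinuousMap.homotopic_of_homotopic_comp_of_bijective`);
* `Literature.Topology.FourManifolds.HandleAttachingMap.exists_diffeomorph_attachingCircle₅_eq`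
  — **for two finite families `h`, `h'` of attaching maps on such a `V` with pairwise disjoint
  ranges whose circles represent the same classes `g i`, there is a diffeomorphism `Φ` of `V`
  with `Φ ∘ (attaching circle of `h i`) = attaching circle of `h' i`** for all `i`
  (`BoundaryData.exists_diffeomorph_apply_incl_of_homotopic_links`: Whitney for links in the
  closed 4-manifold `∂V`, isotopy extension, collar) — *"in dimension 5 the attaching circles are
  determined by the relators"* (Kirby 1989, p. 18; Andrews–Curtis 1965).

Everything here is proved; no named facts are introduced.

## References

* R. C. Kirby, *The topology of 4-manifolds*, LNM 1374 (1989), Ch. I, p. 18. [Kirby1989]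
* A. A. Kosinski, *Differential Manifolds* (1993), VI §7 (proof of (7.2)), VII §7. [Kosinski1993]
* H. Whitney, Ann. of Math. 37 (1936), 645–680. [Whitney1936]
* A. Hatcher, *Algebraic Topology* (2002), §1.1, Ex. 6. [HatcherAT2002]
-/

open scoped Manifold ContDiff Topology
open Function Set

noncomputable section

namespace Literature.Topology.FourManifolds

universe u

/-! ### Homotopic links in `∂W` differ by a diffeomorphism of `W` (dimension `≥ 5`) -/

section Links

variable {n : ℕ} {W : Type u} [TopologicalSpace W] [T2Space W] [SecondCountableTopology W]
  [CompactSpace W] [ChartedSpace (EuclideanHalfSpace (n + 1)) W] [IsManifold (𝓡∂ (n + 1)) ∞ W]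

/-- **Componentwise-homotopic links in `∂W` differ by a diffeomorphism of `W`** (`dim W ≥ 5`):
Whitney's theorem for links (`exists_smoothIsotopy_link_of_homotopic`) gives an isotopy of links
in the closed manifold `b.carrier ≅ ∂W`, which is realised by a diffeomorphism of `W`
(`BoundaryData.exists_diffeomorph_apply_incl_of_smoothIsotopy_family`: isotopy extension in
`∂W` and extension over a collar). [cite: Kirby1989, Ch. I, p. 18] [cite: Kosinski1993, VI §7, proof of (7.2)]
[cite: Whitney1936] -/
theorem BoundaryData.exists_diffeomorph_apply_incl_of_homotopic_links (hn : 4 ≤ n)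
    (b : BoundaryData (𝓡∂ (n + 1)) W (𝓡 n)) {m : ℕ}
    (e₀ e₁ : Fin m → C(Metric.sphere (0 : EuclideanSpace ℝ (Fin 2)) 1, b.carrier))
    (he₀ : ∀ i, Manifold.IsSmoothEmbedding (𝓡 1) (𝓡 n) ∞ (e₀ i))
    (he₁ : ∀ i, Manifold.IsSmoothEmbedding (𝓡 1) (𝓡 n) ∞ (e₁ i))
    (hd₀ : ∀ i j, i ≠ j → ∀ u u', e₀ i u ≠ e₀ j u')
    (hd₁ : ∀ i j, i ≠ j → ∀ u u', e₁ i u ≠ e₁ j u')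
    (h : ∀ i, (e₀ i).Homotopic (e₁ i)) :
    ∃ Φ : W ≃ₘ⟮𝓡∂ (n + 1), 𝓡∂ (n + 1)⟯ W, ∀ i u, Φ (b.incl (e₀ i u)) = b.incl (e₁ i u) := by
  haveI : CompactSpace b.carrier := b.compactSpace_carrier
  haveI : T2Space b.carrier := b.isSmoothEmbedding.isEmbedding.t2Space
  obtain ⟨F, hF⟩ := exists_smoothIsotopy_link_of_homotopic hn e₀ e₁ he₀ he₁ hd₀ hd₁ h
  exact b.exists_diffeomorph_apply_incl_of_smoothIsotopy_family F hF

end Links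

namespace HandleAttachingMap

variable {V : Type u} [TopologicalSpace V] [ChartedSpace (EuclideanHalfSpace (4 + 1)) V]

/-- The attaching circle as a continuous map of the circle. [folklore] -/
def attachingCircle₅CM (h : HandleAttachingMap 4 2 V) :
    C(Metric.sphere (0 : EuclideanSpace ℝ (Fin 2)) 1, V) :=
  ⟨h.attachingCircle₅, h.continuous_attachingCircle₅⟩

/-- Unfolding lemma. [folklore] -/
@[simp] theorem attachingCircle₅CM_apply (h : HandleAttachingMap 4 2 V)
    (θ : Metric.sphere (0 : EuclideanSpace ℝ (Fin 2)) 1) :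
    h.attachingCircle₅CM θ = h.attachingCircle₅ θ := rfl

/-- The loop of the attaching circle (as a circle map) is the attaching loop. [folklore] -/
theorem circleLoop_attachingCircle₅CM (h : HandleAttachingMap 4 2 V) :
    h.attachingCircle₅CM.circleLoop = h.attachingLoop₅ := by
  ext t
  rfl

/-- **Attaching circles representing the same class are homotopic as maps of the circle**
(in `V`): both based loops `δ · ℓ · δ⁻¹`, `δ' · ℓ' · δ'⁻¹` have class `g`, so the circle maps
are freely homotopic (`ContinuousMap.homotopic_of_conj_mk_circleLoop_eq`).
[cite: HatcherAT2002, §1.1, Ex. 6] -/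
theorem attachingCircle₅_homotopic_of_representsClass {h h' : HandleAttachingMap 4 2 V} {v : V}
    {g : FundamentalGroup V v} (hg : h.RepresentsClass g) (hg' : h'.RepresentsClass g) :
    h.attachingCircle₅CM.Homotopic h'.attachingCircle₅CM := by
  obtain ⟨δ, hδ⟩ := hg
  obtain ⟨δ', hδ'⟩ := hg'
  refine ContinuousMap.homotopic_of_conj_mk_circleLoop_eq (v := v) (e₀ := h.attachingCircle₅CM)
    (e₁ := h'.attachingCircle₅CM) δ δ' ?_
  -- the loop of the circle map is the attaching loop, definitionally
  exact hδ.trans hδ'.symm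

variable [T2Space V] [SecondCountableTopology V] [CompactSpace V] [ConnectedSpace V]
  [IsManifold (𝓡∂ (4 + 1)) ∞ V]

/-- The lifted attaching circle as a continuous map into the boundary 4-manifold. [folklore] -/
def boundaryCircle₅CM (b : BoundaryData (𝓡∂ (4 + 1)) V (𝓡 4)) (h : HandleAttachingMap 4 2 V) :
    C(Metric.sphere (0 : EuclideanSpace ℝ (Fin 2)) 1, b.carrier) :=
  ⟨h.boundaryCircle₅ b, (h.isSmoothEmbedding_boundaryCircle₅ b).isEmbedding.continuous⟩

omit [SecondCountableTopology V] [CompactSpace V] [ConnectedSpace V] in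
/-- Unfolding lemma. [folklore] -/
@[simp] theorem boundaryCircle₅CM_apply (b : BoundaryData (𝓡∂ (4 + 1)) V (𝓡 4))
    (h : HandleAttachingMap 4 2 V) (θ : Metric.sphere (0 : EuclideanSpace ℝ (Fin 2)) 1) :
    h.boundaryCircle₅CM b θ = h.boundaryCircle₅ b θ := rfl

omit [SecondCountableTopology V] [CompactSpace V] [ConnectedSpace V] in
/-- The lifted circle followed by the inclusion is the attaching circle (as continuous maps).
[folklore] -/
theorem inclContinuousMap_comp_boundaryCircle₅CM (b : BoundaryData (𝓡∂ (4 + 1)) V (𝓡 4))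
    (h : HandleAttachingMap 4 2 V) :
    b.inclContinuousMap.comp (h.boundaryCircle₅CM b) = h.attachingCircle₅CM := by
  ext θ
  exact h.incl_boundaryCircle₅ b θ

/-- **Attaching circles representing the same class are homotopic in the boundary 4-manifold**
of a compact connected 5-manifold `V` with a `(1, r)` handle decomposition: they are homotopic
in `V` (`attachingCircle₅_homotopic_of_representsClass`), `π₁(b.carrier) → π₁(V)` is bijective
(`HasHandleDecomposition.bijective_mapOfEq_inclContinuousMap`, dual handles of dimension `≥ 3`)
and `b.carrier` is path connected, so the homotopy pulls back
(`ContinuousMap.homotopic_of_homotopic_comp_of_bijective`). [cite: Kosinski1993, VII §7]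
[cite: HatcherAT2002, §1.1, Ex. 6 and Prop. 1.26] -/
theorem boundaryCircle₅_homotopic_of_representsClass {r : ℕ}
    (hV : HasHandleDecomposition 4 V (handleCount 1 r)) (b : BoundaryData (𝓡∂ (4 + 1)) V (𝓡 4))
    {h h' : HandleAttachingMap 4 2 V} {v : V} {g : FundamentalGroup V v}
    (hg : h.RepresentsClass g) (hg' : h'.RepresentsClass g) :
    (h.boundaryCircle₅CM b).Homotopic (h'.boundaryCircle₅CM b) := by
  haveI := hV.pathConnectedSpace_carrier b (by norm_num)
  refine ContinuousMap.homotopic_of_homotopic_comp_of_bijective b.inclContinuousMap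
    (PathConnectedSpace.somePath _ _) (hV.bijective_mapOfEq_inclContinuousMap b (by norm_num) _) ?_
  rw [inclContinuousMap_comp_boundaryCircle₅CM, inclContinuousMap_comp_boundaryCircle₅CM]
  exact attachingCircle₅_homotopic_of_representsClass hg hg'

/-- **Families of attaching circles representing the same classes differ by a diffeomorphism of
the 1-handlebody.**  Let `V` be a compact connected 5-manifold with boundary with a handle
decomposition into one 0-handle and `r` 1-handles, and `h h' : Fin m → HandleAttachingMap 4 2 V`
two families of attaching maps of 2-handles, each with pairwise disjoint ranges, whose attaching
circles represent the same classes `g i ∈ π₁(V, v)`.  Then some diffeomorphism `Φ` of `V` carries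
each attaching circle of `h` onto the corresponding one of `h'`, as parametrised circles:
the lifted circles are two links in the closed 4-manifold `∂V`, homotopic component by component
(`boundaryCircle₅_homotopic_of_representsClass`), hence isotopic as links (Whitney, dimension
`4`), and the isotopy is realised by a diffeomorphism of `V`
(`BoundaryData.exists_diffeomorph_apply_incl_of_homotopic_links`).
[cite: Kirby1989, Ch. I, p. 18] [cite: Kosinski1993, VI §7, proof of (7.2)] -/
theorem exists_diffeomorph_attachingCircle₅_eq {r m : ℕ}
    (hV : HasHandleDecomposition 4 V (handleCount 1 r))
    (h h' : Fin m → HandleAttachingMap 4 2 V)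
    (hd : Pairwise fun i j => Disjoint (range (h i).toFun) (range (h j).toFun))
    (hd' : Pairwise fun i j => Disjoint (range (h' i).toFun) (range (h' j).toFun))
    {v : V} (g : Fin m → FundamentalGroup V v)
    (hg : ∀ i, (h i).RepresentsClass (g i)) (hg' : ∀ i, (h' i).RepresentsClass (g i)) :
    ∃ Φ : V ≃ₘ⟮𝓡∂ (4 + 1), 𝓡∂ (4 + 1)⟯ V,
      ∀ i θ, Φ ((h i).attachingCircle₅ θ) = (h' i).attachingCircle₅ θ := by
  set b := BoundaryManifold.boundaryData 4 V with hb
  obtain ⟨Φ, hΦ⟩ := b.exists_diffeomorph_apply_incl_of_homotopic_links (le_refl 4)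
    (fun i => (h i).boundaryCircle₅CM b) (fun i => (h' i).boundaryCircle₅CM b)
    (fun i => (h i).isSmoothEmbedding_boundaryCircle₅ b)
    (fun i => (h' i).isSmoothEmbedding_boundaryCircle₅ b)
    (fun i j hij u u' => boundaryCircle₅_ne b (hd hij) u u')
    (fun i j hij u u' => boundaryCircle₅_ne b (hd' hij) u u')
    (fun i => boundaryCircle₅_homotopic_of_representsClass hV b (hg i) (hg' i))
  refine ⟨Φ, fun i θ => ?_⟩
  have e := hΦ i θ
  simp only [boundaryCircle₅CM_apply, incl_boundaryCircle₅] at e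
  exact e

end HandleAttachingMap

end Literature.Topology.FourManifolds
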